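import Literature.Barriers.QuantumAdvantage.TensorNetworkContractionTreewidth
import Literature.LinearAlgebra.TensorNetworks.Elimination
import HarnessLib

/-!
# Barrier catalogue `QuantumAdvantage` — the elimination schedule of a rooted tree decomposition (Markov–Shi Prop 4.2) and its width

Companion to `TensorNetworkContractionTreewidth.lean` (`RootedTreeDecomposition G k`: bags on the
indices `0, …, k-1`, a parent map with `parent i < i`, rooted (T3) `mem_bag_parent`; the input of
Step 3 of Markov–Shi's Thm 4.6 as restated in `markovShi2008_thm46`) and to
`Literature/LinearAlgebra/TensorNetworks/Elimination.lean` (`TFactor.elimVar`, `TFactor.elimList`,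
the invariant `Elim.Inv`). Markov–Shi, proof of Prop. 4.2: "Choose a leaf `ℓ` … let `ℓ'` be its
parent. If `B_ℓ ⊆ B_ℓ'`, remove `ℓ` … Otherwise, let `e ∈ B_ℓ − B_ℓ'`. Output `e`, remove it …
Note that each output `e` appears in only one bag … Therefore, all (current) neighbors of `e` must
appear in the same bag. Hence its induced width is at most `d`." On a ROOTED decomposition the
leaves-first order is simply "bag indices downwards", so the schedule is:

* `RootedTreeDecomposition.elimAt D i` — the variables output at bag `i`: `B_i \ B_{parent i}`
  (`B_0` at the root); they lie in no bag of smaller index (`not_mem_bag_of_mem_elimAt`), the sets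
  are pairwise disjoint (`disjoint_elimAt`) and cover every variable lying in some bag
  (`exists_mem_elimAt`);
* `RootedTreeDecomposition.Homed D live pool` — every factor of the pool has its scope inside a bag
  whose index is still `live`; **`Homed.elimVar`**: eliminating `v ∈ elimAt i` (with `i` the largest
  live index) keeps the pool homed AND the product formed in this step has scope `⊆ B_i` — the width
  statement of Prop 4.2; `Homed.erase`: once `elimAt i` is gone, bag `i ≠ 0` can be retired (its
  factors move to `parent i`);
* `RootedTreeDecomposition.runFrom D l m`, `run D l` — process the bags `k-1, …, 0`, eliminating at
  bag `i` the list `l i` (any duplicate-free enumeration of `elimAt i`), and **`run_inv`** /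
  **`value_eq_prod_run`**: started on the pool of a network whose factors are homed in `D` and whose
  variables all lie in bags, the run ends with every variable eliminated, so the value of the network
  is the product of the constants left (`Elim.Inv.value_eq`) — Steps 3–4 of Thm 4.6, given the
  decomposition, at the level of mathematical objects. The machine realisation is the sequel's.

## References

* [MarkovShi2008] I. L. Markov, Y. Shi, *Simulating quantum computation by contracting tensor
  networks*, SIAM J. Comput. 38 (2008) 963–981 (arXiv:quant-ph/0511069), §4: Prop. 4.2 and its
  proof (p. 9), Thm. 4.6 (Steps 3–4, p. 10). Read via `lit read paper:arxiv-quant-ph_0511069`.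
-/

namespace Literature.Barriers.QuantumAdvantage

open Finset Literature.LinearAlgebra.TensorNetworks

namespace RootedTreeDecomposition

variable {V : Type*} [DecidableEq V] {Gp : SimpleGraph V} {k : ℕ}

/-! ### The variables output at a bag -/

/-- **The variables output at bag `i`** in the leaves-first schedule of Markov–Shi's Prop. 4.2 on a
rooted decomposition: `B_i \ B_{parent i}`, and the whole root bag at `i = 0`.
[cite: MarkovShi2008, §4 (proof of Prop 4.2: "let e ∈ B_ℓ − B_ℓ'. Output e")] -/
def elimAt (D : RootedTreeDecomposition Gp k) (i : Fin k) : Finset V :=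
  if (i : ℕ) = 0 then D.bag i else D.bag i \ D.bag (D.parent i)

/-- Output variables lie in their bag. [folklore] -/
theorem elimAt_subset_bag (D : RootedTreeDecomposition Gp k) (i : Fin k) : D.elimAt i ⊆ D.bag i := by
  unfold elimAt
  split_ifs
  · exact Subset.rfl
  · exact sdiff_subset

/-- **"Each output `e` appears in only one bag"**: a variable output at bag `i` lies in no bag of
smaller index (rooted (T3)). [cite: MarkovShi2008, §4 (proof of Prop 4.2)] -/
theorem not_mem_bag_of_mem_elimAt (D : RootedTreeDecomposition Gp k) {v : V} {i j : Fin k}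
    (hv : v ∈ D.elimAt i) (hj : (j : ℕ) < i) : v ∉ D.bag j := by
  intro hvj
  unfold elimAt at hv
  split_ifs at hv with h0
  · omega
  · rw [mem_sdiff] at hv
    exact hv.2 (D.mem_bag_parent v i hv.1 ⟨j, hvj, hj⟩)

/-- The output sets of distinct bags are disjoint. [cite: MarkovShi2008, §4 (proof of Prop 4.2)] -/
theorem disjoint_elimAt (D : RootedTreeDecomposition Gp k) {i i' : Fin k} (h : i ≠ i') :
    Disjoint (D.elimAt i) (D.elimAt i') := by
  rw [disjoint_left]
  intro v hv hv'
  rcases lt_or_gt_of_ne (Fin.val_ne_of_ne h) with hlt | hlt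
  · exact D.not_mem_bag_of_mem_elimAt hv' hlt (D.elimAt_subset_bag i hv)
  · exact D.not_mem_bag_of_mem_elimAt hv hlt (D.elimAt_subset_bag i' hv')

/-- **Every variable lying in some bag is output exactly once, at the least bag containing it.**
[cite: MarkovShi2008, §4 (proof of Prop 4.2: "until all vertices of the tree decomposition are removed")] -/
theorem exists_mem_elimAt (D : RootedTreeDecomposition Gp k) {v : V} (h : ∃ i, v ∈ D.bag i) :
    ∃ i, v ∈ D.elimAt i := by
  classical
  obtain ⟨i, hi⟩ := h
  have hne : (univ.filter fun j : Fin k => v ∈ D.bag j).Nonempty := ⟨i, by simp [hi]⟩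
  obtain ⟨m, hmM, hmin⟩ := (univ.filter fun j : Fin k => v ∈ D.bag j).exists_min_image
    (fun j => (j : ℕ)) hne
  have hvm : v ∈ D.bag m := by simpa using hmM
  refine ⟨m, ?_⟩
  unfold elimAt
  split_ifs with h0
  · exact hvm
  · rw [mem_sdiff]
    refine ⟨hvm, fun hp => ?_⟩
    have hle : (m : ℕ) ≤ D.parent m := hmin (D.parent m) (by simpa using hp)
    have hlt := D.parent_lt m (Nat.pos_of_ne_zero h0)
    omega

/-! ### Homed pools and one elimination step -/

section Homed

variable {R : Type*} [CommSemiring R] {Dom : Type*}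

/-- `Homed D live pool`: every factor of the pool has its scope inside some bag whose index is in
`live` (the bags not yet removed in the schedule of Prop. 4.2). [cite: MarkovShi2008, §4 (proof of Prop 4.2)] -/
def Homed (D : RootedTreeDecomposition Gp k) (live : Finset (Fin k)) (pool : List (TFactor R V Dom)) : Prop :=
  ∀ f ∈ pool, ∃ j ∈ live, f.scope ⊆ D.bag j

omit [DecidableEq V] in
/-- `Homed` is monotone in the live set. [folklore] -/
theorem Homed.mono {D : RootedTreeDecomposition Gp k} {live live' : Finset (Fin k)}
    {pool : List (TFactor R V Dom)} (h : Homed D live pool) (hl : live ⊆ live') : Homed D live' pool :=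
  fun f hf => (h f hf).imp fun _ ⟨hj, hs⟩ => ⟨hl hj, hs⟩

/-- **Retiring a bag** ("if `B_ℓ ⊆ B_ℓ'`, remove `ℓ`"): once the variables output at bag `i ≠ 0`
have been eliminated (no scope meets `elimAt i`), every factor homed at `i` is homed at `parent i`,
so `i` may be dropped from the live set. [cite: MarkovShi2008, §4 (proof of Prop 4.2)] -/
theorem Homed.erase {D : RootedTreeDecomposition Gp k} {live : Finset (Fin k)}
    {pool : List (TFactor R V Dom)} (h : Homed D live pool) {i : Fin k} (hi0 : (i : ℕ) ≠ 0)
    (hpi : D.parent i ∈ live) (hdisj : ∀ f ∈ pool, Disjoint f.scope (D.elimAt i)) :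
    Homed D (live.erase i) pool := by
  intro f hf
  obtain ⟨j, hj, hfj⟩ := h f hf
  by_cases hji : j = i
  · subst hji
    refine ⟨D.parent j, mem_erase.2 ⟨fun hp => ?_, hpi⟩, fun x hx => ?_⟩
    · have := D.parent_lt j (Nat.pos_of_ne_zero hi0)
      rw [hp] at this
      exact lt_irrefl _ this
    · by_contra hxp
      have hxe : x ∈ D.elimAt j := by
        unfold elimAt
        rw [if_neg hi0, mem_sdiff]
        exact ⟨hfj hx, hxp⟩
      exact disjoint_left.1 (hdisj f hf) hx hxe
  · exact ⟨j, mem_erase.2 ⟨hji, hj⟩, hfj⟩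

variable [Fintype Dom]

/-- **The width statement of Prop. 4.2, one step.** If the pool is homed in the live bags, `i` is
the largest live index and `v` is output at bag `i`, then every factor carrying `v` is homed at `i`
("all (current) neighbors of `e` must appear in the same bag"), so the product formed when
eliminating `v` has scope `⊆ B_i` ("its induced width is at most `d`"), and the pool stays homed.
[cite: MarkovShi2008, §4 (proof of Prop 4.2)] -/
theorem Homed.elimVar {D : RootedTreeDecomposition Gp k} {live : Finset (Fin k)}
    {pool : List (TFactor R V Dom)} (h : Homed D live pool) {i : Fin k} (hi : i ∈ live)
    (hmax : ∀ j ∈ live, (j : ℕ) ≤ i) {v : V} (hv : v ∈ D.elimAt i) :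
    (TFactor.prodList (pool.filter fun f => v ∈ f.scope)).scope ⊆ D.bag i ∧
      Homed D live (TFactor.elimVar v pool) := by
  -- every factor carrying `v` is homed at `i`
  have key : ∀ f ∈ pool, v ∈ f.scope → f.scope ⊆ D.bag i := by
    intro f hf hvf
    obtain ⟨j, hj, hfj⟩ := h f hf
    rcases (hmax j hj).lt_or_eq with hlt | heq
    · exact absurd (hfj hvf) (D.not_mem_bag_of_mem_elimAt hv hlt)
    · rwa [Fin.ext heq] at hfj
  have hprod : (TFactor.prodList (pool.filter fun f => v ∈ f.scope)).scope ⊆ D.bag i := by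
    intro x hx
    obtain ⟨f, hf, hxf⟩ := TFactor.mem_scope_prodList.1 hx
    rw [List.mem_filter, decide_eq_true_eq] at hf
    exact key f hf.1 hf.2 hxf
  refine ⟨hprod, fun g hg => ?_⟩
  rcases TFactor.mem_elimVar_iff.1 hg with rfl | ⟨hg, -⟩
  · exact ⟨i, hi, (erase_subset _ _).trans hprod⟩
  · exact h g hg

end Homed

/-! ### The run over the bags `k-1, …, 0` -/

section Run

variable {R : Type*} [CommSemiring R] {Dom Factor : Type*} [Fintype Dom]

/-- **Processing the bags of index `< m`, downwards** (`m-1` first): at bag `i` eliminate the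
variables `l i` (an enumeration of `elimAt D i`). [cite: MarkovShi2008, §4 (proof of Prop 4.2, Thm 4.6 Step 3)] -/
def runFrom (D : RootedTreeDecomposition Gp k) (l : Fin k → List V) :
    ℕ → List (TFactor R V Dom) → List (TFactor R V Dom)
  | 0, pool => pool
  | m + 1, pool => runFrom D l m (if h : m < k then TFactor.elimList (l ⟨m, h⟩) pool else pool)

/-- **The whole schedule**: all bags, from `k-1` down to the root. [cite: MarkovShi2008, §4 (Prop 4.2, Thm 4.6 Step 3)] -/
def run (D : RootedTreeDecomposition Gp k) (l : Fin k → List V) (pool : List (TFactor R V Dom)) :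
    List (TFactor R V Dom) :=
  D.runFrom l k pool

/-- The variables eliminated once the bags of index `≥ m` are processed. [folklore] -/
def elimFrom (D : RootedTreeDecomposition Gp k) (m : ℕ) : Finset V :=
  (univ.filter fun i : Fin k => m ≤ (i : ℕ)).biUnion D.elimAt

/-- The live bags once the bags of index `≥ m` are processed: indices `< m`, and the root. [folklore] -/
def liveBelow (k m : ℕ) : Finset (Fin k) :=
  univ.filter fun i : Fin k => (i : ℕ) < m ∨ (i : ℕ) = 0

/-- Nothing is eliminated before the run. [folklore] -/
theorem elimFrom_of_le (D : RootedTreeDecomposition Gp k) {m : ℕ} (hm : k ≤ m) : D.elimFrom m = ∅ := by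
  ext v
  simp only [elimFrom, mem_biUnion, mem_filter, mem_univ, true_and, notMem_empty, iff_false,
    not_exists, not_and]
  intro i hi
  have := i.isLt
  omega

/-- Membership in `elimFrom`. [folklore] -/
theorem mem_elimFrom (D : RootedTreeDecomposition Gp k) {m : ℕ} {v : V} :
    v ∈ D.elimFrom m ↔ ∃ i : Fin k, m ≤ (i : ℕ) ∧ v ∈ D.elimAt i := by
  simp [elimFrom]

/-- Processing bag `m` adds `elimAt m` to the eliminated variables. [folklore] -/
theorem elimFrom_succ_union (D : RootedTreeDecomposition Gp k) {m : ℕ} (hm : m < k) :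
    D.elimFrom (m + 1) ∪ D.elimAt ⟨m, hm⟩ = D.elimFrom m := by
  ext v
  simp only [mem_union, mem_elimFrom]
  constructor
  · rintro (⟨i, hi, hv⟩ | hv)
    · exact ⟨i, by omega, hv⟩
    · exact ⟨⟨m, hm⟩, le_rfl, hv⟩
  · rintro ⟨i, hi, hv⟩
    rcases hi.lt_or_eq with hlt | heq
    · exact Or.inl ⟨i, hlt, hv⟩
    · right
      have : (⟨m, hm⟩ : Fin k) = i := Fin.ext heq
      rwa [this]

/-- After the whole run every covered variable is eliminated. [folklore] -/
theorem elimFrom_zero (D : RootedTreeDecomposition Gp k) [Fintype V] (hcover : ∀ v, ∃ i, v ∈ D.bag i) :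
    D.elimFrom 0 = univ := by
  ext v
  simp only [mem_elimFrom, zero_le, true_and, mem_univ, iff_true]
  exact D.exists_mem_elimAt (hcover v)

variable [Fintype V] [DecidableEq Dom] [Fintype Factor]

/-- **The invariant of the run** at stage `m` (bags of index `≥ m` processed): the eliminated
variables are `elimFrom m` (`Elim.Inv`) and the pool is homed in the bags of index `< m` and the
root. [cite: MarkovShi2008, §4 (proof of Prop 4.2)] -/
structure RunInv (N : TensorNetwork R V Dom Factor) (D : RootedTreeDecomposition Gp k) (m : ℕ)
    (pool : List (TFactor R V Dom)) : Prop where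
  /-- The elimination invariant for the variables output at the processed bags. -/
  inv : Elim.Inv N (D.elimFrom m) pool
  /-- The pool is homed in the unprocessed bags (and the root). -/
  homed : D.Homed (liveBelow k m) pool

/-- Eliminating, at bag `⟨m, hm⟩` (the largest live index), a duplicate-free list of its output
variables that are not yet eliminated: the invariants are kept, the eliminated set grows by the
list. [cite: MarkovShi2008, §4 (proof of Prop 4.2)] -/
theorem inv_homed_elimList {N : TensorNetwork R V Dom Factor} {D : RootedTreeDecomposition Gp k}
    {m : ℕ} (hm : m < k) :
    ∀ (l : List V) {E : Finset V} {pool : List (TFactor R V Dom)},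
      Elim.Inv N E pool → D.Homed (liveBelow k (m + 1)) pool → l.Nodup →
      (∀ v ∈ l, v ∈ D.elimAt ⟨m, hm⟩ ∧ v ∉ E) →
      Elim.Inv N (E ∪ l.toFinset) (TFactor.elimList l pool) ∧
        D.Homed (liveBelow k (m + 1)) (TFactor.elimList l pool)
  | [], E, pool, hI, hH, _, _ => by simpa using And.intro hI hH
  | v :: l, E, pool, hI, hH, hnd, hl => by
    rw [List.nodup_cons] at hnd
    obtain ⟨hv, hvE⟩ := hl v List.mem_cons_self
    have hI' := hI.elimVar hvE
    have hH' := (hH.elimVar (i := ⟨m, hm⟩) (by simp [liveBelow]) (fun j hj => by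
      simp only [liveBelow, mem_filter, mem_univ, true_and] at hj
      simp only
      omega) hv).2
    have h := inv_homed_elimList hm l hI' hH' hnd.2 fun u hu => by
      refine ⟨(hl u (List.mem_cons_of_mem v hu)).1, ?_⟩
      rw [mem_insert, not_or]
      exact ⟨fun huv => hnd.1 (huv ▸ hu), (hl u (List.mem_cons_of_mem v hu)).2⟩
    have hE : insert v E ∪ l.toFinset = E ∪ (v :: l).toFinset := by
      ext x
      simp only [mem_union, mem_insert, List.toFinset_cons, List.mem_toFinset]
      tauto
    rw [TFactor.elimList_cons, ← hE]
    exact h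

/-- **One bag of the schedule**: from stage `m + 1` to stage `m` (`m < k`), eliminating any
duplicate-free enumeration of `elimAt m` and then retiring bag `m` (unless it is the root).
[cite: MarkovShi2008, §4 (proof of Prop 4.2)] -/
theorem RunInv.step {N : TensorNetwork R V Dom Factor} {D : RootedTreeDecomposition Gp k} {m : ℕ}
    (hm : m < k) {pool : List (TFactor R V Dom)} (h : RunInv N D (m + 1) pool) {l : List V}
    (hnd : l.Nodup) (hl : ∀ v, v ∈ l ↔ v ∈ D.elimAt ⟨m, hm⟩) :
    RunInv N D m (TFactor.elimList l pool) := by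
  have hfresh : ∀ v ∈ l, v ∈ D.elimAt ⟨m, hm⟩ ∧ v ∉ D.elimFrom (m + 1) := by
    intro v hv
    refine ⟨(hl v).1 hv, fun hE => ?_⟩
    obtain ⟨i, hi, hvi⟩ := D.mem_elimFrom.1 hE
    have hne : (⟨m, hm⟩ : Fin k) ≠ i := fun h => by
      have := congrArg Fin.val h
      simp only at this
      omega
    exact disjoint_left.1 (D.disjoint_elimAt hne) ((hl v).1 hv) hvi
  obtain ⟨hI, hH⟩ := inv_homed_elimList hm l h.inv h.homed hnd hfresh
  have hset : D.elimFrom (m + 1) ∪ l.toFinset = D.elimFrom m := by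
    rw [← D.elimFrom_succ_union hm]
    congr 1
    ext v
    rw [List.mem_toFinset, hl]
  rw [hset] at hI
  refine ⟨hI, ?_⟩
  rcases Nat.eq_zero_or_pos m with rfl | hpos
  · -- the root is never retired: `liveBelow k 1 = liveBelow k 0`
    refine hH.mono fun i hi => ?_
    simp only [liveBelow, mem_filter, mem_univ, true_and] at hi ⊢
    omega
  · have hlive : liveBelow k m = (liveBelow k (m + 1)).erase ⟨m, hm⟩ := by
      ext i
      simp only [liveBelow, mem_filter, mem_univ, true_and, mem_erase, ne_eq, Fin.ext_iff]
      omega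
    rw [hlive]
    refine hH.erase (i := ⟨m, hm⟩) (by simp only; omega) ?_ fun f hf => ?_
    · have hp := D.parent_lt ⟨m, hm⟩ hpos
      simp only [liveBelow, mem_filter, mem_univ, true_and]
      left
      simp only at hp
      omega
    · exact (hI.disjoint f hf).mono_right fun v hv =>
        D.mem_elimFrom.2 ⟨⟨m, hm⟩, le_rfl, hv⟩

/-- **The run keeps the invariant down to stage `0`.** [cite: MarkovShi2008, §4 (proof of Prop 4.2)] -/
theorem RunInv.runFrom {N : TensorNetwork R V Dom Factor} {D : RootedTreeDecomposition Gp k}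
    {l : Fin k → List V} (hl : ∀ i, (l i).Nodup ∧ ∀ v, v ∈ l i ↔ v ∈ D.elimAt i) :
    ∀ (m : ℕ) {pool : List (TFactor R V Dom)}, m ≤ k → RunInv N D m pool →
      RunInv N D 0 (D.runFrom l m pool)
  | 0, _, _, h => h
  | m + 1, pool, hmk, h => by
    have hm : m < k := hmk
    rw [RootedTreeDecomposition.runFrom, dif_pos hm]
    exact RunInv.runFrom hl m hm.le (h.step hm (hl _).1 (hl _).2)

/-- **The initial stage**: a pool satisfying the elimination invariant with nothing eliminated and
homed anywhere in `D` is at stage `k`. [folklore] -/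
theorem runInv_start {N : TensorNetwork R V Dom Factor} {D : RootedTreeDecomposition Gp k}
    {pool : List (TFactor R V Dom)} (hI : Elim.Inv N ∅ pool) (hH : D.Homed univ pool) :
    RunInv N D k pool := by
  have hlive : liveBelow k k = univ := by
    ext i
    simp [liveBelow]
  refine ⟨by rwa [D.elimFrom_of_le le_rfl], ?_⟩
  rw [hlive]
  exact hH

/-- **The run of the schedule on the pool of a network** whose tensors are homed in the rooted
decomposition `D`: it ends with the elimination invariant for every variable lying in a bag — all
variables, when the bags cover them. [cite: MarkovShi2008, §4 (Prop 4.2, Thm 4.6 Steps 3–4)] -/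
theorem run_inv (N : TensorNetwork R V Dom Factor) (D : RootedTreeDecomposition Gp k)
    {l : Fin k → List V} (hl : ∀ i, (l i).Nodup ∧ ∀ v, v ∈ l i ↔ v ∈ D.elimAt i)
    (hhome : D.Homed univ (TFactor.initPool N)) (hcover : ∀ v, ∃ i, v ∈ D.bag i) :
    Elim.Inv N univ (D.run l (TFactor.initPool N)) := by
  have h := (RunInv.runFrom hl k le_rfl (runInv_start (Elim.inv_initPool N) hhome)).inv
  rw [D.elimFrom_zero hcover] at h
  exact h

/-- **Markov–Shi Thm 4.6, Steps 3–4, machine-independently**: contracting the network along the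
schedule of a rooted tree decomposition in which every tensor is homed and every index lies in some
bag leaves constants whose product is the value of the network — with Prop. 3.5
(`acceptProb_eq_value_segmentNetwork`) the acceptance probability of the circuit.
[cite: MarkovShi2008, §4 (Thm 4.6, Steps 3–4) and §3 (Prop 3.5)] -/
theorem value_eq_prod_run (N : TensorNetwork R V Dom Factor) (D : RootedTreeDecomposition Gp k)
    {l : Fin k → List V} (hl : ∀ i, (l i).Nodup ∧ ∀ v, v ∈ l i ↔ v ∈ D.elimAt i)
    (hhome : D.Homed univ (TFactor.initPool N)) (hcover : ∀ v, ∃ i, v ∈ D.bag i) (a : V → Dom) :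
    N.value = ((D.run l (TFactor.initPool N)).map fun f => f.fn a).prod :=
  (run_inv N D hl hhome hcover).value_eq a

end Run

end RootedTreeDecomposition

end Literature.Barriers.QuantumAdvantage
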